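import Summits.ABC.ABC.Theses.YuMatveevShapeRat
import Summits.ABC.StewartYu.PadicG3SatFrameD
import Summits.ABC.StewartYu.PadicG3SatNRecord
import Summits.ABC.StewartYu.PadicG3ParNBudgetF
import Literature.NumberTheory.Transcendental.Nesterenko2003Prop51Holds
import HarnessLib

set_option linter.dupNamespace false

/-!
# LINE `sat-odd` (v2 FINAL, SORRY-FREE — the stub discharged by name; crux CLOSED 2026-08-27T21:26:25Z by ✓ p572760
# `Summit.ABC.ABC.Cruxes.PadicCoreOddRat.SatOddG3Frame.PadicCoreOddRat_proof`, module `Summits.ABC.ABC.Theorems.YuMatveevShapeRatPadicCoreOddRatLine`)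
# — crux `PadicCoreOddRat` (stmt-ABC-20503): the 𝔑-threaded (saturated, Kummer-free) odd-`p` Gen-3 frame

Lead p2 (g6).  Architecture of record = memo-07 Θ′ («θ-algebra, α-sizes, ξ-END»).  The COMPOSITION is PROVED through the landed chain
`GenThreeFrameSpecOddRat.padicCoreOddRatText_of_frame_two_le` (ranks 0/1 elementary, all signs by squaring) ∘
`G3Setup.frameOddRatPos_of_recordSatR` (START → k-chain → Kummer half-steps with signed floor parts → levels → output at `ξ = α^{1/N}` with
`MomentGL`) ∘ `Nesterenko2003_prop51_holds`, in the INDEX-IDENTITY form `frameOddRatPos_of_recordSatRD` (v2, 2026-08-27 19:2xZ: the record's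
Siegel count over the skew family needs `N = |det C|`, threaded by `SatKitD` / `RecordSupplyOddSatRD` of `PadicG3SatFrameD`); the lattice kit is
DISCHARGED (`satKitD_all`, from p1's `SatBasisReduced.exists_reduced_satFrame`); what remains is ONE stub:

* `stub_recordSat` — the RECORD `RecordSupplyOddSatRD CLine p n` at every odd prime and rank `n ≥ 2` (p1 `PadicG3ParN` family + the pack
  `IneqPackSat` through `G3Setup.recordSupplyAtSatR_of_pack`; landed pieces: `PadicG3SatNSched/NSizes/NSizesB/NHalfSizes/NEnd/OrdLine/LineAlg`).
-/

open Finset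

namespace Summit.ABC.ABC.Cruxes.PadicCoreOddRat.SatOddG3Frame

open Summit.ABC.StewartYu Summit.ABC.StewartYu.GenThreeFrameSpecOddRat Summit.ABC.StewartYu.GenThreeInductionOddRat
open Literature.NumberTheory.Transcendental Literature.NumberTheory.Transcendental.GaGm

/-- The constant of the line (PLACEHOLDER value `2^{111}`; the records fix it — any `c ≥ 2` keeps the composition). -/
noncomputable def cLine : ℝ := (2 : ℝ) ^ 111

/-- The constant FUNCTION of record `C m = cLine ^ m`. -/
noncomputable def CLine (m : ℕ) : ℝ := cLine ^ m

theorem CLine_bounds : ∀ r, 0 ≤ CLine r ∧ CLine r ≤ cLine ^ r := fun r => ⟨by unfold CLine cLine; positivity, le_rfl⟩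

theorem two_le_CLine_one : 2 ≤ CLine 1 := by
  unfold CLine cLine; norm_num

namespace Sig

/-- Statement of `stub_recordSat` — the record: at every odd prime and every rank `n ≥ 2`, the saturated record supply in index-identity form
(`G3Setup.RecordSupplyOddSatRD CLine p n`, by name). -/
def stub_recordSat : Prop := ∀ (p : ℕ) [Fact p.Prime], p ≠ 2 → ∀ n, 2 ≤ n → G3Setup.RecordSupplyOddSatRD CLine p n

end Sig


/-- STUB (RECORD) — DISCHARGED by name exactly as in the landed closer (✓ p572760): `G3Setup.recordSupplyOddSatRD_of_headline` (✓
`PadicG3SatNRecord`, p2) at p1's headline `PadicG3ParN.headline_N` (✓ `PadicG3ParNBudgetF`), `4·2^{100} ≤ 2^{111}`. -/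
theorem stub_recordSat : Sig.stub_recordSat := by
  intro p _ hp2 n hn
  show G3Setup.RecordSupplyOddSatRD (fun m => ((2 : ℝ) ^ 111) ^ m) p n
  exact G3Setup.recordSupplyOddSatRD_of_headline hn hp2 (by norm_num) (by positivity) (by norm_num)
    (fun P hθ hNq hA1 hAmax hK₀ => P.headline_N hθ hn hNq hA1 hAmax hK₀)

/-- Composition: the crux BY NAME from the one open stub statement, through the ✓ lattice kit `satKitD_all`, the ✓ frame
`G3Setup.frameOddRatPos_of_recordSatRD`, the ✓ shell `padicCoreOddRatText_of_frame_two_le` and the ✓ zero estimate `Nesterenko2003_prop51_holds`;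
no sorry of its own. -/
theorem PadicCoreOddRat_of : Sig.stub_recordSat →
    Summit.ABC.ABC.Theses.YuMatveevShapeRat.PadicCoreOddRat := by
  intro hR
  have hK : ∀ n, SatKitD n := satKitD_all
  have hF : Nesterenko2003_prop51 → ∀ p : ℕ, p.Prime → p ≠ 2 → ∀ n, 2 ≤ n → FrameOddRatPos CLine p n := by
    intro _ p hp hp2 n hn
    haveI : Fact p.Prime := ⟨hp⟩
    exact G3Setup.frameOddRatPos_of_recordSatRD (by omega) hp2 (hK n) (hR p hp2 n hn)
  exact padicCoreOddRatText_of_frame_two_le CLine_bounds two_le_CLine_one hF Nesterenko2003_prop51_holds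

/-- The crux along THIS line's composition, sorry-free (equal by proof-irrelevance to the landed ✓ `PadicCoreOddRat_proof`). -/
theorem PadicCoreOddRat_line : Summit.ABC.ABC.Theses.YuMatveevShapeRat.PadicCoreOddRat := PadicCoreOddRat_of stub_recordSat

end Summit.ABC.ABC.Cruxes.PadicCoreOddRat.SatOddG3Frame
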